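import Summits.BirchSwinnertonDyer.BirchSwinnertonDyer.Theorems.Rank2Observatory2DescClFieldCertESQ
import Summits.BirchSwinnertonDyer.BirchSwinnertonDyer.Theorems.Rank2Observatory2DescClRealCertE2Defs
import HarnessLib

/-!
# BirchSwinnertonDyer — rank ≥ 2 observatory: KERNEL-2DESC-CL, SQ3 — TWO-VIEW RECORDS AND CHECKERS OVER A TOTALLY SPLIT `q` (TOTALLY REAL)

HONEST FRAMING: per-curve certified theorems and census instruments; no claim on BSD in rank ≥ 2.

Third generic file of the split-`q` variant (design `…/kernel-2desc-cl/v2/generics/cq/PLAN-g51.md`): the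
per-curve RECORDS and the computable CHECKERS of the totally real two-view `Cl`-certificate when the auxiliary
prime `q` is totally split, `(q) = W_0 W_1 W_2` (SQ1).  Pure data and `Bool`-valued functions; soundness is SQ4,
the rank theorem SQ5.  The field records `ClFieldCertE2` / `ClFieldCertRE2` are REUSED as types with the split-`q`
field checkers `ClFieldCertRE.checkRE3` / `ClFieldCertRE2.check2R3` (archimedean clause and constants clause
verbatim, two-view core = `checkCoreE3` of SQ2).

What changes against the landed `…ClCurveCertE2Defs` / `…ClRealCertE2Defs` (where `(q) = W₁W₂²`):
* a generic family entry `FamEntry3` carries the index `c : Fin 3` of THE ONE prime above `q` it may meet,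
  its order `e = ord_{W_c}(x)` (certified by the `q`-part of `|N(X)|`, `ordCheck`) and TWO `invCert` data
  excluding `X` from `W_{c+1}`, `W_{c+2}`; the element `q` (kind `1`) has `ord = 1` at all three;
* the curve record `ClCurveCertE3` carries THREE `invCert` data `X_D ∉ W_0, W_1, W_2`;
* the parity matrix has `chars.length + 6` rows: signs at `ρ₀, ρ₁, ρ₂`, parities of `ord_{W_0}, ord_{W_1},
  ord_{W_2}`, Euler bits; the sieve carries the three `ord` parities.
Everything else (two-view clause, norm factorisation with per-prime dispatch, support-code clause, sign clauses,
`θ_E`-order, sieve `admStd3RQ`, survivor count) is the landed text over the new record types.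

No theorems beyond definitional projections; sorry-free; axioms standard.
[cite: Cassels1991LecturesEllipticCurves, §15] [cite: Cohen1993, §4.8.2, §6.5]
-/

set_option linter.dupNamespace false

noncomputable section

open Polynomial NumberField IsDedekindDomain Module
open Literature.NumberTheory.NumberFields

namespace Summit.BirchSwinnertonDyer.BirchSwinnertonDyer.Rank2Observatory.TwoDescCl

open TwoDescCubic ClFieldCert

/-! ## Field checkers (split `q`) on the reused real field records -/

namespace ClFieldCertRE

variable (fre : ClFieldCertRE)

/-- **The totally real two-view field checker over a totally split `q`**: archimedean clause (landed) and the
split-`q` two-view core `checkCoreE3` (SQ2). Computable. -/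
def checkRE3 : Bool := fre.re.checkArch && fre.toE.checkCoreE3

/-- The archimedean clause of a checked record. -/
theorem checkArch_of_checkRE3 (hE : fre.checkRE3 = true) : fre.re.checkArch = true := by
  simp only [checkRE3, Bool.and_eq_true] at hE; exact hE.1

/-- The split-`q` two-view core clause of a checked record. -/
theorem checkCoreE3_of_checkRE3 (hE : fre.checkRE3 = true) : fre.toE.checkCoreE3 = true := by
  simp only [checkRE3, Bool.and_eq_true] at hE; exact hE.2

end ClFieldCertRE

namespace ClFieldCertRE2

variable (G : ClFieldCertRE2)

/-- **The per-field checker (split `q`)**: `checkRE3` and the constants clause of the multipliers (landed).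
Computable; `decide +kernel` once per field. -/
def check2R3 : Bool := G.fre.checkRE3 && G.toE2.checkConst

/-- The real field clause of a checked record-with-multipliers. -/
theorem checkRE3_of_check2R3 (h : G.check2R3 = true) : G.fre.checkRE3 = true := by
  simp only [check2R3, Bool.and_eq_true] at h; exact h.1

/-- The multiplier/Bezout clause of a checked record-with-multipliers. -/
theorem const_of_check2R3 (h : G.check2R3 = true) : G.toE2.checkConst = true := by
  simp only [check2R3, Bool.and_eq_true] at h; exact h.2

/-- The archimedean clause of a checked record-with-multipliers. -/
theorem checkArch_of_check2R3 (h : G.check2R3 = true) : G.fre.re.checkArch = true :=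
  G.fre.checkArch_of_checkRE3 (G.checkRE3_of_check2R3 h)

/-- The split-`q` two-view core clause of a checked record-with-multipliers. -/
theorem checkCoreE3_of_check2R3 (h : G.check2R3 = true) : G.toE2.fe.checkCoreE3 = true :=
  G.fre.checkCoreE3_of_checkRE3 (G.checkRE3_of_check2R3 h)

end ClFieldCertRE2

/-! ## Records -/

/-- **A two-view family entry over a totally split `q`**: `kind` (`1` = the element `q`, anything else generic),
`X = m₁x` in `α`-coordinates, `Y = m₂x` in `η`-coordinates, the sign bit at `ρ₀`, the index `c` of the one prime
above `q` the element may meet, `e = ord_{W_c}(x)`, the `invCert` data `X ∉ W_{c+1}`, `X ∉ W_{c+2}`, the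
factorisation `nf` of `|N(X)|`, and the `invCert` exclusions from non-support code primes in each view. Pure data. -/
structure FamEntry3 where
  /-- `1` = the element `q`; otherwise generic -/
  kind : ℕ
  /-- `m₁ · x` in `α`-coordinates -/
  X : ℤ × ℤ × ℤ
  /-- `m₂ · x` in `η`-coordinates -/
  Y : ℤ × ℤ × ℤ
  /-- sign bit at the real place `ρ₀` (`true` = negative) -/
  sg : Bool
  /-- the index of the prime above `q` carrying `x` -/
  c : Fin 3
  /-- `ord_{W_c}(x)` -/
  e : ℕ
  /-- `invCert` datum: `X ∉ W_{c+1}` -/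
  inv2 : ℤ × ℤ × ℤ
  /-- `invCert` datum: `X ∉ W_{c+2}` -/
  inv3 : ℤ × ℤ × ℤ
  /-- factorisation of `|N(X)|` -/
  nf : List (ℕ × ℕ)
  /-- `α`-view exclusions `(code, invCert datum)` -/
  invsA : List (PCode × (ℤ × ℤ × ℤ))
  /-- `η`-view exclusions `(code, invCert datum)` -/
  invsE : List (PCode × (ℤ × ℤ × ℤ))

/-- **Two-view per-curve certificate over a totally split `q`** for `y² = x³ + Ax² + Bx + C`: as the landed
`ClCurveCertE2` with THREE `invCert` data `X_D ∉ W_0, W_1, W_2` and `FamEntry3` family entries. Pure data.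
[cite: Cassels1991LecturesEllipticCurves, §15] -/
structure ClCurveCertE3 where
  /-- the model `(0, A, 0, B, C)` -/
  A : ℤ
  /-- the model -/
  B : ℤ
  /-- the model -/
  C : ℤ
  /-- irreducibility modulus for `X³ + AX² + BX + C` -/
  pF : ℕ
  /-- `m₁ · e` in `α`-coordinates -/
  Xt : ℤ × ℤ × ℤ
  /-- `m₂ · e` in `η`-coordinates -/
  Yt : ℤ × ℤ × ℤ
  /-- `m₁ · F′(e)` in `α`-coordinates -/
  XD : ℤ × ℤ × ℤ
  /-- `m₂ · F′(e)` in `η`-coordinates -/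
  YD : ℤ × ℤ × ℤ
  /-- factorisation of `|N(X_D)|` -/
  dn : List (ℕ × ℕ)
  /-- `α`-view exclusions for `D` -/
  dinvA : List (PCode × (ℤ × ℤ × ℤ))
  /-- `η`-view exclusions for `D` -/
  dinvE : List (PCode × (ℤ × ℤ × ℤ))
  /-- `invCert` datum: `X_D ∉ W_0` -/
  dW0 : ℤ × ℤ × ℤ
  /-- `invCert` datum: `X_D ∉ W_1` -/
  dW1 : ℤ × ℤ × ℤ
  /-- `invCert` datum: `X_D ∉ W_2` -/
  dW2 : ℤ × ℤ × ℤ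
  /-- sieve moduli -/
  Q : List ℕ
  /-- the head of the family: `−1, ε₁, ε₂, γ_0, γ_1, q` (SIX entries in the totally real checker: `|T| = codes + 3`) -/
  head : List FamEntry3
  /-- the support codes, tagged by view (`true` = `α`), each with its family element -/
  codes : List ((Bool × PCode) × FamEntry3)

namespace ClCurveCertE3

/-- The `invCert` datum `X_D ∉ W_i`. -/
def dW (cc : ClCurveCertE3) (i : Fin 3) : ℤ × ℤ × ℤ := ![cc.dW0, cc.dW1, cc.dW2] i

end ClCurveCertE3

/-- **Totally real two-view per-curve record over a totally split `q`**: the curve record, the sign bits at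
`ρ₁, ρ₂` of every family element keyed by its `α`-view coordinates `X`, and the `θ_E`-order of the places. -/
structure ClCurveCertE3R where
  cc : ClCurveCertE3
  sgn : List ((ℤ × ℤ × ℤ) × Bool × Bool)
  o₀ : Fin 3
  o₁ : Fin 3
  o₂ : Fin 3

namespace ClCurveCertE3R

variable (ccr : ClCurveCertE3R)

/-- Sign bit at `ρ₁` of the element with `α`-view coordinates `X` (table lookup; `false` if absent). -/
def sg₂ (X : ℤ × ℤ × ℤ) : Bool :=
  match ccr.sgn.find? fun e => e.1 == X with
  | some e => e.2.1
  | none => false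

/-- Sign bit at `ρ₂` of the element with `α`-view coordinates `X` (table lookup; `false` if absent). -/
def sg₃ (X : ℤ × ℤ × ℤ) : Bool :=
  match ccr.sgn.find? fun e => e.1 == X with
  | some e => e.2.2
  | none => false

end ClCurveCertE3R

/-! ## The checkers -/

section Checkers

variable (F : ClFieldCertE2) (cc : ClCurveCertE3)

/-- The family: head entries then the code elements. -/
def fam3 : List FamEntry3 := cc.head ++ cc.codes.map Prod.snd

/-- **Prime dispatch** (landed text over the new record type): the rational prime `p` of a norm factorisation
is `q`, or has an `α`-row each of whose codes is a support code or misses the element, or an `η`-row likewise. -/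
def primeDispatch3 (X Y : ℤ × ℤ × ℤ) (invsA invsE : List (PCode × (ℤ × ℤ × ℤ))) (p : ℕ) : Bool :=
  (p == F.fe.base.q) ||
    ((F.fe.base.primes.any fun e => e.p == p) &&
      ((F.fe.base.row p).codes.all fun C' => decide ((true, C') ∈ cc.codes.map Prod.fst) ||
        invsA.any fun ci => ci.1 == C' && invCert F.fe.base.a F.fe.base.b F.fe.base.c C' X ci.2)) ||
    ((F.fe.primesE.any fun e => e.p == p) &&
      ((F.fe.rowE p).codes.all fun C' => decide ((false, C') ∈ cc.codes.map Prod.fst) ||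
        invsE.any fun ci => ci.1 == C' && invCert F.fe.a' F.fe.b' F.fe.c' C' Y ci.2))

/-- **Support-code clause**: the code is present in its view's registry and its prime contains `D`. -/
def codeClause3 (bc : (Bool × PCode) × FamEntry3) : Bool :=
  if bc.1.1 then
    (F.fe.base.primes.any fun e => e.p == bc.1.2.1) && decide (bc.1.2 ∈ (F.fe.base.row bc.1.2.1).codes) &&
      memCode bc.1.2 cc.XD
  else
    (F.fe.primesE.any fun e => e.p == bc.1.2.1) && decide (bc.1.2 ∈ (F.fe.rowE bc.1.2.1).codes) &&
      memCode bc.1.2 cc.YD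

/-- **Kind clause (split `q`)**: the element `q` is literally `X = (m₁ q, 0, 0)`; a generic element misses the
two primes `W_{c+1}`, `W_{c+2}` above `q` other than its carrier and has certified `ord_{W_c}` (the `q`-part of
`|N(X)|`). Computable. -/
def famKindCheck3 (f : FamEntry3) : Bool :=
  if f.kind = 1 then decide (f.X = ((F.m₁ : ℤ) * F.fe.base.q, 0, 0))
  else invCert F.fe.base.a F.fe.base.b F.fe.base.c (F.fe.base.wq (f.c + 1)) f.X f.inv2 &&
    invCert F.fe.base.a F.fe.base.b F.fe.base.c (F.fe.base.wq (f.c + 2)) f.X f.inv3 &&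
    ordCheck F.fe.base.q (normFormZ F.fe.base.a F.fe.base.b F.fe.base.c f.X.1 f.X.2.1 f.X.2.2).natAbs f.e

/-- **The two-view family-entry check (split `q`)** (landed clauses, split-`q` kind clause). Computable.
[cite: Cassels1991LecturesEllipticCurves, §15] -/
def famCheckE3 (f : FamEntry3) : Bool :=
  twoViewCheck F.fe.base.a F.fe.base.b F.fe.base.c F.fe.u F.fe.d F.m₁ F.m₂ f.X f.Y &&
    signCond F.fe.base.lo F.fe.base.hi f.X f.sg &&
    decide (normFormZ F.fe.base.a F.fe.base.b F.fe.base.c f.X.1 f.X.2.1 f.X.2.2 ≠ 0) &&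
    decide (((F.m₁ : ℤ)) ^ 3 ∣ normFormZ F.fe.base.a F.fe.base.b F.fe.base.c f.X.1 f.X.2.1 f.X.2.2) &&
    (F.fe.base.chars.all fun ch => !decide ((ch.1 : ℤ) ∣ evalInt ch.2.1 f.X)) &&
    decide ((normFormZ F.fe.base.a F.fe.base.b F.fe.base.c f.X.1 f.X.2.1 f.X.2.2).natAbs =
      (f.nf.map fun pe => pe.1 ^ pe.2).prod) &&
    (f.nf.all fun pe => primeDispatch3 F cc f.X f.Y f.invsA f.invsE pe.1) &&
    famKindCheck3 F f

/-- `log ord_{W_j}`: `−1` for `q`, `−e` at the carrier of a generic element, `0` at the other two. -/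
def famL3 (j : Fin 3) (f : FamEntry3) : ℤ := if f.kind = 1 then -1 else if j = f.c then -(f.e : ℤ) else 0

/-- The norms of the family (`N(x) = N(X) / m₁³`). -/
def famNorm3 (j : Fin (fam3 cc).length) : ℤ :=
  normFormZ F.fe.base.a F.fe.base.b F.fe.base.c ((fam3 cc).get j).X.1 ((fam3 cc).get j).X.2.1
    ((fam3 cc).get j).X.2.2 / (F.m₁ : ℤ) ^ 3

end Checkers

section CheckersR

variable (G : ClFieldCertRE2) (ccr : ClCurveCertE3R)

/-- **Family-entry checker (totally real, split `q`)**: `famCheckE3` (sign clause at `ρ₀`) and the sign clauses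
at `ρ₁`, `ρ₂`, all read on `X = m₁·x`. -/
def famCheckE3R (f : FamEntry3) : Bool :=
  famCheckE3 G.toE2 ccr.cc f &&
    signCond G.fre.re.lo₂ G.fre.re.hi₂ f.X (ccr.sg₂ f.X) &&
    signCond G.fre.re.lo₃ G.fre.re.hi₃ f.X (ccr.sg₃ f.X)

/-- Sign bit of the entry `f` at place `k`. -/
def sgAt3 (f : FamEntry3) (k : Fin 3) : Bool :=
  if k = 0 then f.sg else if k = 1 then ccr.sg₂ f.X else ccr.sg₃ f.X

/-- Row `k` of the parity matrix at the entry `f`: `0, 1, 2` the signs at `ρ₀, ρ₁, ρ₂`, `3, 4, 5` the parities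
of `ord_{W_0}, ord_{W_1}, ord_{W_2}`, `6 + i` the Euler bit of the `i`-th residue character (all on `X`). -/
def bitRowR3 (fc : ClFieldCert) (f : FamEntry3) : ℕ → Bool
  | 0 => f.sg
  | 1 => ccr.sg₂ f.X
  | 2 => ccr.sg₃ f.X
  | 3 => !decide ((2 : ℤ) ∣ famL3 0 f)
  | 4 => !decide ((2 : ℤ) ∣ famL3 1 f)
  | 5 => !decide ((2 : ℤ) ∣ famL3 2 f)
  | k + 6 => eulerBit (fc.chars.getD k (3, 0, 0)).1 (evalInt (fc.chars.getD k (3, 0, 0)).2.1 f.X)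

/-- The parity matrix. -/
def bitR3 (k : Fin (G.toE2.fe.base.chars.length + 6)) (j : Fin (fam3 ccr.cc).length) : Bool :=
  bitRowR3 ccr G.toE2.fe.base ((fam3 ccr.cc).get j) k

/-- **The sieve** on pairs `(T, U)` (`T = ∅`): norm-square residues modulo `Q` and the three-real-place sign
conditions in `θ_E`-order (`admStd3RQ`, norms `N(X)/m₁³`), parities of `ord_{W_0}, ord_{W_1}, ord_{W_2}`. -/
def admR3 (T : Finset (Fin 0)) (U : Finset (Fin (fam3 ccr.cc).length)) : Bool :=
  admStd3RQ ccr.cc.Q (fun i : Fin 0 => i.elim0) (famNorm3 G.toE2 ccr.cc) (fun i : Fin 0 => i.elim0)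
      (fun i : Fin 0 => i.elim0) (fun i : Fin 0 => i.elim0)
      (fun j => sgAt3 ccr ((fam3 ccr.cc).get j) ccr.o₀) (fun j => sgAt3 ccr ((fam3 ccr.cc).get j) ccr.o₁)
      (fun j => sgAt3 ccr ((fam3 ccr.cc).get j) ccr.o₂) T U &&
    decide (Even (U.filter fun j => bitRowR3 ccr G.toE2.fe.base ((fam3 ccr.cc).get j) 3 = true).card) &&
    decide (Even (U.filter fun j => bitRowR3 ccr G.toE2.fe.base ((fam3 ccr.cc).get j) 4 = true).card) &&
    decide (Even (U.filter fun j => bitRowR3 ccr G.toE2.fe.base ((fam3 ccr.cc).get j) 5 = true).card)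

/-- **Core clauses of the totally real two-view per-curve checker over a totally split `q`** (everything but
the survivor count): the landed clauses of `checkE2R` over the new records, THREE `invCert` data
`X_D ∉ W_0, W_1, W_2`, a head of SIX field-level elements (`dim 𝓞_{K,T}^× / squares = 3 + |T| = codes + 6`) and
the parity certificate with `chars.length + 6` rows. Computable. [cite: Cassels1991LecturesEllipticCurves, §15] -/
def checkE3RCore : Bool :=
  decide (deltaShort ccr.cc.A ccr.cc.B ccr.cc.C ≠ 0) &&
    noRootMod ccr.cc.pF ccr.cc.A ccr.cc.B ccr.cc.C &&
    decide (cubicAtCoords G.toE2.fe.base.a G.toE2.fe.base.b G.toE2.fe.base.c ((G.toE2.m₁ : ℤ) * ccr.cc.A)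
      ((G.toE2.m₁ : ℤ) ^ 2 * ccr.cc.B) ((G.toE2.m₁ : ℤ) ^ 3 * ccr.cc.C) ccr.cc.Xt = (0, 0, 0)) &&
    decide (derivAtCoords G.toE2.fe.base.a G.toE2.fe.base.b G.toE2.fe.base.c ((G.toE2.m₁ : ℤ) * ccr.cc.A)
      ((G.toE2.m₁ : ℤ) ^ 2 * ccr.cc.B) ccr.cc.Xt =
      MonicCubic.mulCoords G.toE2.fe.base.a G.toE2.fe.base.b G.toE2.fe.base.c (smulCoords (G.toE2.m₁ : ℤ) ccr.cc.XD)
        (prodPowCoords G.toE2.fe.base.a G.toE2.fe.base.b G.toE2.fe.base.c [])) &&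
    twoViewCheck G.toE2.fe.base.a G.toE2.fe.base.b G.toE2.fe.base.c G.toE2.fe.u G.toE2.fe.d G.toE2.m₁ G.toE2.m₂
      ccr.cc.Xt ccr.cc.Yt &&
    twoViewCheck G.toE2.fe.base.a G.toE2.fe.base.b G.toE2.fe.base.c G.toE2.fe.u G.toE2.fe.d G.toE2.m₁ G.toE2.m₂
      ccr.cc.XD ccr.cc.YD &&
    decide (0 < MonicCubic.disc ccr.cc.A ccr.cc.B ccr.cc.C) &&
    decide (normFormZ G.toE2.fe.base.a G.toE2.fe.base.b G.toE2.fe.base.c ccr.cc.XD.1 ccr.cc.XD.2.1 ccr.cc.XD.2.2 ≠ 0) &&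
    decide ((normFormZ G.toE2.fe.base.a G.toE2.fe.base.b G.toE2.fe.base.c ccr.cc.XD.1 ccr.cc.XD.2.1
      ccr.cc.XD.2.2).natAbs = (ccr.cc.dn.map fun pe => pe.1 ^ pe.2).prod) &&
    (ccr.cc.dn.all fun pe => primeDispatch3 G.toE2 ccr.cc ccr.cc.XD ccr.cc.YD ccr.cc.dinvA ccr.cc.dinvE pe.1) &&
    (ccr.cc.codes.all fun bc => codeClause3 G.toE2 ccr.cc bc) &&
    invCert G.toE2.fe.base.a G.toE2.fe.base.b G.toE2.fe.base.c (G.toE2.fe.base.wq 0) ccr.cc.XD ccr.cc.dW0 &&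
    invCert G.toE2.fe.base.a G.toE2.fe.base.b G.toE2.fe.base.c (G.toE2.fe.base.wq 1) ccr.cc.XD ccr.cc.dW1 &&
    invCert G.toE2.fe.base.a G.toE2.fe.base.b G.toE2.fe.base.c (G.toE2.fe.base.wq 2) ccr.cc.XD ccr.cc.dW2 &&
    (ccr.cc.Q.all fun q => decide (0 < q)) &&
    decide (ccr.cc.head.length = 6) &&
    ((fam3 ccr.cc).all fun f => famCheckE3R G ccr f) &&
    (linLtCond (G.fre.re.I ccr.o₀).1 (G.fre.re.I ccr.o₀).2 (G.fre.re.I ccr.o₁).1 (G.fre.re.I ccr.o₁).2 ccr.cc.Xt &&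
      linLtCond (G.fre.re.I ccr.o₁).1 (G.fre.re.I ccr.o₁).2 (G.fre.re.I ccr.o₂).1 (G.fre.re.I ccr.o₂).2 ccr.cc.Xt) &&
    decide (∀ T : Finset (Fin (fam3 ccr.cc).length), T ≠ ∅ →
      ∃ k : Fin (G.toE2.fe.base.chars.length + 6), Odd (T.filter fun j => bitR3 G ccr k j = true).card)

/-- **The totally real two-view per-curve checker for `rank ≤ r` over a totally split `q`**: the core clauses and
the count of sieve survivors `≤ 2 ^ r`. Computable; run by `decide +kernel`. (Refinements of the sieve — e.g. nodal
local conditions — reuse `checkE3RCore` and count over `admR3 ∧ extra`, see `rank_le_of_checkE3RX`.)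
[cite: Cassels1991LecturesEllipticCurves, §15] -/
def checkE3R (r : ℕ) : Bool :=
  checkE3RCore G ccr &&
    decide (((Finset.univ ×ˢ Finset.univ).filter
      (fun p : Finset (Fin 0) × Finset (Fin (fam3 ccr.cc).length) => admR3 G ccr p.1 p.2 = true)).card ≤ 2 ^ r)

end CheckersR

end Summit.BirchSwinnertonDyer.BirchSwinnertonDyer.Rank2Observatory.TwoDescCl

end
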